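import Summits.BirchSwinnertonDyer.BirchSwinnertonDyer.Theorems.PrintCf2SplitBadTwoLineDecompVbarTrivial
import Summits.BirchSwinnertonDyer.BirchSwinnertonDyer.Theorems.PrintCf2SplitBadTwoLocalControlKernelDyadicSeven
import HarnessLib

/-!
# Road α, crux `PrintCf2.SplitBadTwoRankOneOfFacts` (stmt-BirchSwinnertonDyer-20368), stub S3d — class (iii), the EVEN half: for `d ≡ 14 (mod 16)` the
# decomposition group of the line `K*_∞` above `v̄` acts TRIVIALLY on `W*`; the whole class (iii) `d ≡ 3 (mod 8) ∨ d ≡ 14 (mod 16)` in one statement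

Cell `bsd-print-cf2`, width seat `bsd-line-cf2-p1-w6` g5 (S3d: «𝓗 local + ch(𝓗^∨)(0) per class», file C of the class-(iii) series); `--supports
stmt-BirchSwinnertonDyer-20368 --as helper`. HONEST FRAMING: nothing here closes the crux or a registered stub; no summit statement is proved by this seat;
BSD is not proved by any of this. No definition, no named fact, no `sorry`.

Frame: member `C • W = cm7^{(d)}` (`d ≠ 0`), `K` imaginary quadratic, `2 = v v̄`, `W* = ↥((W.baseChange K).endEigenPrimaryTorsion 2 π r)` pinned at `v`, `κ'` a
`ℤ₂`-line unramified outside `v̄`, `D″ := D_v̄ ∩ ker κ'`.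
* **`smul_eq_self_of_mem_decomp_vbar_inf_kerSubgroup_of_frame_even_seven`** (`d = 2d'`, `d' ≡ 7 (mod 8)`, i.e. `d ≡ 14 (mod 16)`): every `δ ∈ D″` fixes
  every point of `W*`. This is B15 file 12's (Hv̄-triv) (-w2 g9 `natCard_localKer_vbar_eq_two_of_frame_of_kerC3_even_seven`, where it is proved INSIDE the
  proof of `#LK_v̄ = 1`), EXPORTED with (C3-loc) discharged by (C3) `mem_kerSubgroup_iff_smul_of_frame`: `√(−d') ∈ K_v̄`, so the sign of `g ∈ D_v̄` on
  `ι√d = ±ι√(−2)·√(−d')` is its sign on `ι√(−2)` (`+1` iff `ε ≡ 1, 3 (mod 8)`); an inertia element acts on a generator `g₈` of `W*[8]` as `s·ε ∈ {1, 3}`,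
  a degree-one element as `s·ε·α⁻¹ ∈ {1, 3}` (`α⁻¹ ≡ 3`); the `δ ∈ D_v̄` acting on `g₈` by `1` or `3` form an open subgroup containing the inertia image
  and a degree-one element, hence ALL of `D_v̄` (`exists_frobPow_generator_decomp`); so no element of `D_v̄` acts as `−1` on `W*`, and an element of
  `ker κ'` (acting as `±1` by (C3)) acts as `+1`. (Proof body adapted from B15 file 12, Steps 1–5.)
* `fixedPoints_decomp_vbar_inf_kerSubgroup_eq_top_of_frame_even_seven` — the same as `(W*)^{D_v̄ ⊓ ker κ'} = ⊤`.
* **`smul_eq_self_of_mem_decomp_vbar_inf_kerSubgroup_of_frame_classThree`** — class (iii) of S3d in ONE statement,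
  `hcl : d % 8 = 3 ∨ (2 ∣ d ∧ (d / 2) % 8 = 7)` (the odd half is -w6 g4's p685012 `smul_eq_self_of_mem_decomp_vbar_inf_kerSubgroup_of_frame`): on class (iii)
  `D″` acts trivially on `W*`, so `H¹(D″, W*) = Hom_cont(D″, W*)` and the local defect group above `v̄` is `Hom_cont(D″/I″, W*)` (files D1–D2 of the series).

presearch: Rubin LNM 1716 §3 Lemma 3.6 (ii), Cor. 3.17; Agboola 2007 §3 Prop. 3.2; Serre 1968 Ch. I §1.2 (`χ_{−2}` via `ζ₈`) — held; tree assembly, no new fact.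
beyond-print theorem: no.

References: [Rubin1999] §3 Lemma 3.6 (ii), Cor. 3.17; [Agboola2007] §3 Prop. 3.2; [SerreAbelianLadic1968] Ch. I §1.2; [NeukirchSchmidtWingberg2008] Thm. 7.5.3.
-/

noncomputable section

open scoped Classical

set_option linter.dupNamespace false
set_option autoImplicit false

open NumberField IsDedekindDomain Field WeierstrassCurve
open Literature.NumberTheory.EllipticCurves Literature.NumberTheory.EllipticCurves.GreenbergSelmer
open Literature.NumberTheory.GaloisRepresentations
open Summit.BirchSwinnertonDyer.BirchSwinnertonDyer.Theorems.PrintCf2.AdditiveAtSeven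
open Summit.BirchSwinnertonDyer.BirchSwinnertonDyer.Theorems.PrintCf2.CMPrimes

namespace Summit.BirchSwinnertonDyer.BirchSwinnertonDyer.Theorems.PrintCf2.RestrictedSelmerPair

variable {K : Type} [Field K] [NumberField K]

/-- **For `d = 2d'`, `d' ≡ 7 (mod 8)` (`d ≡ 14 (mod 16)`) the group `D_v̄ ∩ ker κ'` acts TRIVIALLY on `W*`.** Frame: `C • W = cm7^{(d)}`, `d ≠ 0`; `K`
imaginary quadratic, `2 = v·v̄`; `π² = π − 2`, `r² = r − 2`; pinning clause at `v` for `W* = E[𝔮_r^∞]`; `κ'` unramified outside `v̄`. Every `δ ∈ D_v̄` acts on a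
generator of `W*[8]` by `1` or `3` (inertia: `s·ε`; degree one: `s·ε·α⁻¹`, `s` = the sign on `ι√(−2)` since `√(−d') ∈ K_v̄`; generation by inertia and a
Frobenius lift), so none acts as `−1` on `W*`, and `δ ∈ ker κ'` (acting as `±1` by (C3)) acts as `+1`. B15 file 12's (Hv̄-triv), exported.
[cite: Rubin1999, §3 Lemma 3.6 (ii) and Cor. 3.17] [cite: Agboola2007, §3 Prop. 3.2] [cite: SerreAbelianLadic1968, Ch. I §1.2] -/
theorem smul_eq_self_of_mem_decomp_vbar_inf_kerSubgroup_of_frame_even_seven {d : ℤ} (hd0 : d ≠ 0) (h2d : (2 : ℤ) ∣ d) (hd7 : (d / 2) % 8 = 7)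
    (W : WeierstrassCurve ℚ) [W.IsElliptic] (C : VariableChange ℚ) (hC : C • W = cm7.quadraticTwist (d : ℚ)) (hK : IsImaginaryQuadratic K)
    (v vbar : HeightOneSpectrum (𝓞 K)) (hv : ((2 : ℕ) : 𝓞 K) ∈ v.asIdeal) (hvbar : ((2 : ℕ) : 𝓞 K) ∈ vbar.asIdeal) (hne : vbar ≠ v)
    (π : (W.baseChange K).endRing) (hrel : (π : AddMonoid.End (W.baseChange K).geomPoints) * π = π - 2) {r : ℤ_[2]} (hr : r * r = r - 2)
    (hpin : ∀ τ ∈ GreenbergSelmer.inertia v, ∀ x : ↥((W.baseChange K).endEigenPrimaryTorsion 2 π r), τ • x = x ∨ τ • x = -x)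
    (κ' : ZpExtension K 2) (hκ' : κ'.IsUnramifiedOutside vbar)
    {δ : absoluteGaloisGroup K} (hδD : δ ∈ GreenbergSelmer.decomp vbar) (hδκ : δ ∈ κ'.kerSubgroup)
    (x : ↥((W.baseChange K).endEigenPrimaryTorsion 2 π r)) : δ • x = x := by
  haveI : Fact (Nat.Prime 2) := ⟨Nat.prime_two⟩
  have hj : W.j = -3375 := j_eq_of_smul_eq_cm7Twist hd0 W C hC
  obtain ⟨θ, hθ⟩ := exists_sq_eq_neg_seven_of_cmEndo_mem_endRing W K hj π hrel
  have hK2 : Module.finrank ℚ K = 2 := hK.1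
  -- (C3): `δ` acts on `W*` as `+1` or `−1`
  rcases (mem_kerSubgroup_iff_smul_of_frame hd0 W C hC hK v vbar hv hvbar hne π hrel hr hpin κ' hκ' δ).mp hδκ with h | h
  · exact h x
  exfalso
  obtain ⟨-, -, -, -, -, -, hgen, -⟩ := endEigenPrimaryTorsion_two_structure W hj K hθ π hrel hr
  -- the kernel-type clause (R) at `v̄` for `E[𝔮_r^∞]`
  obtain ⟨hcl', -⟩ := endEigenPrimaryTorsion_two_pinningClause_swap W K hj hK hθ π hrel hr hv hvbar hne hpin
  have hcl'' : ∀ τ ∈ GreenbergSelmer.inertia vbar, ∀ y ∈ (W.baseChange K).endEigenPrimaryTorsion 2 π (1 - r),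
      τ • y = y ∨ τ • y = -y := fun τ hτ y hy ↦ by
    rcases hcl' τ hτ ⟨y, hy⟩ with h | h
    · exact Or.inl (congrArg Subtype.val h)
    · exact Or.inr (congrArg Subtype.val h)
  have h1r : (1 - r) * (1 - r) = (1 - r) - 2 := by linear_combination hr
  have hdQ : (d : ℚ) ≠ 0 := by exact_mod_cast hd0
  obtain ⟨α, hα, -, hUR⟩ := endEigenPrimaryTorsion_two_localTypes_named_of_pinned W K hj hθ π hrel h1r hdQ C hC vbar hvbar
    (inertiaDeg_eq_one_of_ne_two K hK2 hvbar hv hne.symm) hcl''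
  simp only [sub_sub_cancel] at hUR
  have HR := fun σ n hσ s hs ↦ (hUR σ n hσ s hs).2
  -- Step 1: `d = 2d'`, `−d' ≡ 1 (mod 8)`: `√(−d') ∈ K_{v̄}` is fixed by all of `Γ_{K_{v̄}}` (Hensel)
  obtain ⟨d', rfl⟩ := h2d
  have hm8 : (-d') % 8 = 1 := by omega
  obtain ⟨sK, hsK⟩ := exists_sq_eq_adicCompletion_of_emod_eight K vbar hvbar hm8
  set B := WeierstrassCurve.geomSqrt ((-d' : ℤ) : K) with hB_def
  have hBfix : ∀ σ : absoluteGaloisGroup (vbar.adicCompletion K),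
      absGaloisRestrict K (vbar.adicCompletion K) σ • B = ((1 : ℤ) : AlgebraicClosure K) * B := by
    intro σ
    rw [Int.cast_one, one_mul]
    refine absGaloisRestrict_smul_eq_of_mem_range K vbar σ ?_
    set ι := absClosureEmbedding K (vbar.adicCompletion K) with hι
    have hιB : (ι B) ^ 2 = (algebraMap (vbar.adicCompletion K) (AlgebraicClosure (vbar.adicCompletion K)) sK) ^ 2 := by
      rw [← map_pow, hB_def, WeierstrassCurve.geomSqrt_sq, AlgHom.commutes, ← map_pow, hsK,
        ← IsScalarTower.algebraMap_apply K (vbar.adicCompletion K) (AlgebraicClosure (vbar.adicCompletion K))]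
    rcases sq_eq_sq_iff_eq_or_eq_neg.mp hιB with h | h
    · exact ⟨sK, h.symm⟩
    · exact ⟨-sK, by rw [map_neg, h]⟩
  set X := absClosureEmbedding ℚ K (WeierstrassCurve.geomSqrt (-2 : ℚ)) with hX_def
  set A := absClosureEmbedding ℚ K (WeierstrassCurve.geomSqrt (((2 * d' : ℤ)) : ℚ)) with hA_def
  have hXY : (X * B) ^ 2 = A ^ 2 := by
    rw [mul_pow, hX_def, hA_def, hB_def, ← map_pow, ← map_pow, WeierstrassCurve.geomSqrt_sq, WeierstrassCurve.geomSqrt_sq,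
      WeierstrassCurve.geomSqrt_sq, AlgHom.commutes, AlgHom.commutes]
    simp only [map_intCast, map_neg, map_ofNat, map_mul, Int.cast_mul, Int.cast_ofNat, Int.cast_neg]
    ring
  -- Step 2: `α ≡ 3 ≡ α⁻¹ (mod 8)` and the membership test `toZModPow 3 z = 0 ⇒ z ∈ (8)`
  have hα8 : PadicInt.toZModPow 3 ((α : ℤ_[2]ˣ) : ℤ_[2]) = 3 := by
    refine zmod_eight_unitRoot _ (PadicInt.toZModPow 3 ((α⁻¹ : ℤ_[2]ˣ) : ℤ_[2])) ?_ ?_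
    · rw [← map_mul, ← Units.val_mul, mul_inv_cancel, Units.val_one, map_one]
    · have := congrArg (PadicInt.toZModPow 3) hα
      rwa [map_pow, map_sub, map_ofNat] at this
  have hαi : PadicInt.toZModPow 3 ((α⁻¹ : ℤ_[2]ˣ) : ℤ_[2]) = 3 := by
    refine zmod_eight_inv_three _ ?_
    rw [← hα8, ← map_mul, ← Units.val_mul, mul_inv_cancel, Units.val_one, map_one]
  have hmem8 : ∀ z : ℤ_[2], PadicInt.toZModPow 3 z = 0 → z ∈ (Ideal.span {(2 : ℤ_[2]) ^ 3} : Ideal ℤ_[2]) := by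
    intro z hz
    have h := (RingHom.mem_ker (f := PadicInt.toZModPow (p := 2) 3)).mpr hz
    rw [PadicInt.ker_toZModPow] at h
    simpa only [Nat.cast_ofNat] using h
  -- Step 3: a generator `g₈` of `W*[8]`; every element of degree `0` or `1` acts on it by `1` or `3`
  obtain ⟨g₈, hg₈, hord8, -⟩ := hgen 3
  have h8 : 2 ^ 3 • g₈ = 0 := by rw [← hord8]; exact addOrderOf_nsmul_eq_zero g₈
  have key : ∀ (σ : absoluteGaloisGroup (vbar.adicCompletion K)) (n : ℕ), IsFrobPow σ (n : ℤ) → (n = 0 ∨ n = 1) →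
      absGaloisRestrict K (vbar.adicCompletion K) σ • g₈ = g₈ ∨ absGaloisRestrict K (vbar.adicCompletion K) σ • g₈ = 3 • g₈ := by
    intro σ n hσ hn
    set u : ℤ_[2]ˣ := GaloisRep.cyclotomicCharacter K 2 (absGaloisRestrict K (vbar.adicCompletion K) σ) with hu
    have htu : IsUnit (PadicInt.toZModPow 3 (u : ℤ_[2])) := (Units.isUnit u).map _
    -- one leaf: sign `s`, multiplier `N ∈ {1, 3}`, congruence `N ≡ s·ε·α^{-n} (mod 8)`
    have leaf : ∀ s N : ℤ,
        ((absGaloisRestrict K (vbar.adicCompletion K) σ • A = A ∧ s = 1) ∨ (absGaloisRestrict K (vbar.adicCompletion K) σ • A = -A ∧ s = -1)) →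
        (N = 1 ∨ N = 3) → PadicInt.toZModPow 3 ((N : ℤ_[2]) - (s : ℤ_[2]) * ((u * (α⁻¹) ^ n : ℤ_[2]ˣ) : ℤ_[2])) = 0 →
        absGaloisRestrict K (vbar.adicCompletion K) σ • g₈ = g₈ ∨ absGaloisRestrict K (vbar.adicCompletion K) σ • g₈ = 3 • g₈ := by
      intro s N hs hN h0
      have hact := HR σ n hσ s (by rw [hA_def] at hs; exact_mod_cast hs) 3 g₈ hg₈ h8 N (hmem8 _ (by rw [hu] at h0; exact h0))
      rcases hN with rfl | rfl
      · left; rwa [one_zsmul] at hact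
      · right; rwa [show (3 : ℤ) = ((3 : ℕ) : ℤ) from rfl, natCast_zsmul] at hact
    -- the sign of `res σ` on `ι√d` is its sign on `ι√(−2)`
    have hXs := smul_geomSqrt_neg_two_eq_of_cyclotomicCharacter K (absGaloisRestrict K (vbar.adicCompletion K) σ)
    rw [← hu] at hXs
    have hplus : (PadicInt.toZModPow 3 (u : ℤ_[2]) = 1 ∨ PadicInt.toZModPow 3 (u : ℤ_[2]) = 3) →
        absGaloisRestrict K (vbar.adicCompletion K) σ • A = A := fun ht ↦ by
      have hX1 : absGaloisRestrict K (vbar.adicCompletion K) σ • X = ((1 : ℤ) : AlgebraicClosure K) * X := by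
        rw [Int.cast_one, one_mul]; exact hXs.1 ht
      have h := smul_eq_intCast_mul_of_sq_eq _ hXY hX1 (hBfix σ)
      rwa [show ((1 * 1 : ℤ) : AlgebraicClosure K) = 1 by norm_num, one_mul] at h
    have hminus : (PadicInt.toZModPow 3 (u : ℤ_[2]) = 5 ∨ PadicInt.toZModPow 3 (u : ℤ_[2]) = 7) →
        absGaloisRestrict K (vbar.adicCompletion K) σ • A = -A := fun ht ↦ by
      have hX1 : absGaloisRestrict K (vbar.adicCompletion K) σ • X = ((-1 : ℤ) : AlgebraicClosure K) * X := by
        rw [Int.cast_neg, Int.cast_one, neg_one_mul]; exact hXs.2 ht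
      have h := smul_eq_intCast_mul_of_sq_eq _ hXY hX1 (hBfix σ)
      rwa [show ((-1 * 1 : ℤ) : AlgebraicClosure K) = -1 by norm_num, neg_one_mul] at h
    -- the eight leaves `(n, ε mod 8)`
    have hval : ∀ s N : ℤ, PadicInt.toZModPow 3 ((N : ℤ_[2]) - (s : ℤ_[2]) * ((u * (α⁻¹) ^ n : ℤ_[2]ˣ) : ℤ_[2])) =
        (N : ZMod (2 ^ 3)) - (s : ZMod (2 ^ 3)) * (PadicInt.toZModPow 3 (u : ℤ_[2]) * 3 ^ n) := by
      intro s N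
      rw [map_sub, map_mul, map_intCast, map_intCast, Units.val_mul, Units.val_pow_eq_pow_val, map_mul, map_pow, hαi]
    rcases zmod_eight_unit_cases _ htu with ht | ht | ht | ht <;> rcases hn with rfl | rfl
    · exact leaf 1 1 (Or.inl ⟨hplus (Or.inl ht), rfl⟩) (Or.inl rfl) (by rw [hval, ht]; decide)
    · exact leaf 1 3 (Or.inl ⟨hplus (Or.inl ht), rfl⟩) (Or.inr rfl) (by rw [hval, ht]; decide)
    · exact leaf 1 3 (Or.inl ⟨hplus (Or.inr ht), rfl⟩) (Or.inr rfl) (by rw [hval, ht]; decide)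
    · exact leaf 1 1 (Or.inl ⟨hplus (Or.inr ht), rfl⟩) (Or.inl rfl) (by rw [hval, ht]; decide)
    · exact leaf (-1) 3 (Or.inr ⟨hminus (Or.inl ht), rfl⟩) (Or.inr rfl) (by rw [hval, ht]; decide)
    · exact leaf (-1) 1 (Or.inr ⟨hminus (Or.inl ht), rfl⟩) (Or.inl rfl) (by rw [hval, ht]; decide)
    · exact leaf (-1) 1 (Or.inr ⟨hminus (Or.inr ht), rfl⟩) (Or.inl rfl) (by rw [hval, ht]; decide)
    · exact leaf (-1) 3 (Or.inr ⟨hminus (Or.inr ht), rfl⟩) (Or.inr rfl) (by rw [hval, ht]; decide)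
  -- Step 4: the subgroup `U = {δ ∈ D_{v̄} : δ•g₈ ∈ {g₈, 3g₈}}` is open and contains the generators, hence is everything
  have h9 : (3 : ℕ) • (3 : ℕ) • g₈ = g₈ := by
    rw [← mul_nsmul, show (3 * 3 : ℕ) = 2 ^ 3 + 1 from rfl, add_nsmul, h8, one_nsmul, zero_add]
  let U : Subgroup ↥(GreenbergSelmer.decomp vbar) :=
    { carrier := {δ | (δ : absoluteGaloisGroup K) • g₈ = g₈ ∨ (δ : absoluteGaloisGroup K) • g₈ = 3 • g₈}
      one_mem' := Or.inl (by rw [Subgroup.coe_one, one_smul])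
      mul_mem' := fun {a b} ha hb ↦ by
        simp only [Set.mem_setOf_eq, Subgroup.coe_mul, mul_smul] at ha hb ⊢
        rcases hb with hb | hb <;> rw [hb]
        · exact ha
        · rw [smul_comm]
          rcases ha with ha | ha <;> rw [ha]
          · exact Or.inr rfl
          · exact Or.inl h9
      inv_mem' := fun {a} ha ↦ by
        simp only [Set.mem_setOf_eq, Subgroup.coe_inv] at ha ⊢
        rcases ha with ha | ha
        · left
          conv_lhs => rw [← ha]
          rw [inv_smul_smul]
        · right
          have h3 : (a : absoluteGaloisGroup K) • ((3 : ℕ) • g₈) = g₈ := by rw [smul_comm, ha, h9]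
          conv_lhs => rw [← h3]
          rw [inv_smul_smul] }
  obtain ⟨φ, hφ1, hF, hgenU⟩ := exists_frobPow_generator_decomp vbar (D := GreenbergSelmer.decomp vbar) le_rfl le_rfl
  let xm : ↥((W.baseChange K).endEigenPrimaryTorsion 2 π r) := ⟨g₈, hg₈⟩
  have hU : IsOpen (U : Set ↥(GreenbergSelmer.decomp vbar)) := by
    have hcont : Continuous fun g : ↥(GreenbergSelmer.decomp vbar) ↦ g • xm :=
      (continuous_smul_endEigenPrimaryTorsion (W.baseChange K) 2 π r xm).comp continuous_subtype_val
    have hst : IsOpen ((MulAction.stabilizer ↥(GreenbergSelmer.decomp vbar) xm : Subgroup _) : Set ↥(GreenbergSelmer.decomp vbar)) := by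
      have : ((MulAction.stabilizer ↥(GreenbergSelmer.decomp vbar) xm : Subgroup _) : Set ↥(GreenbergSelmer.decomp vbar)) =
          (fun g : ↥(GreenbergSelmer.decomp vbar) ↦ g • xm) ⁻¹' {xm} := by
        ext g; exact MulAction.mem_stabilizer_iff
      rw [this]
      exact hcont.isOpen_preimage _ (isOpen_discrete _)
    refine Subgroup.isOpen_mono (fun g hg ↦ ?_) hst
    rw [MulAction.mem_stabilizer_iff] at hg
    exact Or.inl (congrArg Subtype.val hg)
  have hIU : (GreenbergSelmer.inertia vbar).subgroupOf (GreenbergSelmer.decomp vbar) ≤ U := by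
    intro g hg
    rw [Subgroup.mem_subgroupOf] at hg
    obtain ⟨τ, hτI, hτg⟩ := Subgroup.mem_map.mp hg
    have hτ0 : IsFrobPow τ ((0 : ℕ) : ℤ) := by exact_mod_cast isFrobPow_zero_iff_mem_absInertia.mpr hτI
    change (g : absoluteGaloisGroup K) • g₈ = g₈ ∨ (g : absoluteGaloisGroup K) • g₈ = 3 • g₈
    rw [← hτg]
    exact key τ 0 hτ0 (Or.inl rfl)
  have hFU : (⟨absGaloisRestrict K (vbar.adicCompletion K) φ, hF⟩ : ↥(GreenbergSelmer.decomp vbar)) ∈ U := by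
    have hφ1' : IsFrobPow φ ((1 : ℕ) : ℤ) := by exact_mod_cast hφ1
    exact key φ 1 hφ1' (Or.inr rfl)
  have htop := hgenU U hU hIU hFU
  -- Step 5: `δ ∈ ker κ' ⊓ D_{v̄}` cannot act as `−1`
  have h2g : 2 • g₈ ≠ 0 := fun h ↦ by
    have hdvd : addOrderOf g₈ ∣ 2 := addOrderOf_dvd_of_nsmul_eq_zero h
    rw [hord8] at hdvd
    exact absurd (Nat.le_of_dvd two_pos hdvd) (by norm_num)
  have h4g : 4 • g₈ ≠ 0 := fun h ↦ by
    have hdvd : addOrderOf g₈ ∣ 4 := addOrderOf_dvd_of_nsmul_eq_zero h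
    rw [hord8] at hdvd
    exact absurd (Nat.le_of_dvd (by norm_num) hdvd) (by norm_num)
  have hneg := congrArg Subtype.val (h xm)
  change δ • g₈ = -g₈ at hneg
  have hδU : (⟨δ, hδD⟩ : ↥(GreenbergSelmer.decomp vbar)) ∈ U := htop ▸ Subgroup.mem_top _
  change δ • g₈ = g₈ ∨ δ • g₈ = 3 • g₈ at hδU
  rcases hδU with h1 | h3
  · rw [h1] at hneg
    exact h2g (by rw [two_nsmul]; exact add_eq_zero_iff_eq_neg.mpr hneg)
  · rw [h3] at hneg
    exact h4g (by rw [show (4 : ℕ) = 3 + 1 from rfl, add_nsmul, one_nsmul, hneg, neg_add_cancel])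

/-- **`(W*)^{D_v̄ ⊓ ker κ'} = W*` for `d ≡ 14 (mod 16)`** (fixed subgroup form of the above). [cite: Agboola2007, §3 Prop. 3.2] [cite: GreenbergLNM1716, §3 Lemma 3.3] -/
theorem fixedPoints_decomp_vbar_inf_kerSubgroup_eq_top_of_frame_even_seven {d : ℤ} (hd0 : d ≠ 0) (h2d : (2 : ℤ) ∣ d) (hd7 : (d / 2) % 8 = 7)
    (W : WeierstrassCurve ℚ) [W.IsElliptic] (C : VariableChange ℚ) (hC : C • W = cm7.quadraticTwist (d : ℚ)) (hK : IsImaginaryQuadratic K)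
    (v vbar : HeightOneSpectrum (𝓞 K)) (hv : ((2 : ℕ) : 𝓞 K) ∈ v.asIdeal) (hvbar : ((2 : ℕ) : 𝓞 K) ∈ vbar.asIdeal) (hne : vbar ≠ v)
    (π : (W.baseChange K).endRing) (hrel : (π : AddMonoid.End (W.baseChange K).geomPoints) * π = π - 2) {r : ℤ_[2]} (hr : r * r = r - 2)
    (hpin : ∀ τ ∈ GreenbergSelmer.inertia v, ∀ x : ↥((W.baseChange K).endEigenPrimaryTorsion 2 π r), τ • x = x ∨ τ • x = -x)
    (κ' : ZpExtension K 2) (hκ' : κ'.IsUnramifiedOutside vbar) :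
    FixedPoints.addSubgroup ↥(GreenbergSelmer.decomp vbar ⊓ κ'.kerSubgroup) ↥((W.baseChange K).endEigenPrimaryTorsion 2 π r) = ⊤ := by
  rw [eq_top_iff]
  intro x _
  rw [FixedPoints.mem_addSubgroup]
  rintro ⟨δ, hδD, hδκ⟩
  exact smul_eq_self_of_mem_decomp_vbar_inf_kerSubgroup_of_frame_even_seven hd0 h2d hd7 W C hC hK v vbar hv hvbar hne π hrel hr hpin κ' hκ' hδD hδκ x

/-- **CLASS (iii) OF S3d IN ONE STATEMENT — `d ≡ 3 (mod 8)` or `d ≡ 14 (mod 16)`: `D_v̄ ∩ ker κ'` acts TRIVIALLY on `W*`** (the odd half is -w6 g4's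
`smul_eq_self_of_mem_decomp_vbar_inf_kerSubgroup_of_frame`, p685012). On this class `H¹(D″, W*) = Hom_cont(D″, W*)`, the unramified local classes above `v̄`
are `Hom_cont(D″/I″, W*)`, and the strict/unramified defect is NOT locally finite. [cite: Rubin1999, §3 Cor. 3.17] [cite: Agboola2007, §3 Prop. 3.2] -/
theorem smul_eq_self_of_mem_decomp_vbar_inf_kerSubgroup_of_frame_classThree {d : ℤ} (hd0 : d ≠ 0) (hcl : d % 8 = 3 ∨ ((2 : ℤ) ∣ d ∧ (d / 2) % 8 = 7))
    (W : WeierstrassCurve ℚ) [W.IsElliptic] (C : VariableChange ℚ) (hC : C • W = cm7.quadraticTwist (d : ℚ)) (hK : IsImaginaryQuadratic K)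
    (v vbar : HeightOneSpectrum (𝓞 K)) (hv : ((2 : ℕ) : 𝓞 K) ∈ v.asIdeal) (hvbar : ((2 : ℕ) : 𝓞 K) ∈ vbar.asIdeal) (hne : vbar ≠ v)
    (π : (W.baseChange K).endRing) (hrel : (π : AddMonoid.End (W.baseChange K).geomPoints) * π = π - 2) {r : ℤ_[2]} (hr : r * r = r - 2)
    (hpin : ∀ τ ∈ GreenbergSelmer.inertia v, ∀ x : ↥((W.baseChange K).endEigenPrimaryTorsion 2 π r), τ • x = x ∨ τ • x = -x)
    (κ' : ZpExtension K 2) (hκ' : κ'.IsUnramifiedOutside vbar)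
    {δ : absoluteGaloisGroup K} (hδD : δ ∈ GreenbergSelmer.decomp vbar) (hδκ : δ ∈ κ'.kerSubgroup)
    (x : ↥((W.baseChange K).endEigenPrimaryTorsion 2 π r)) : δ • x = x := by
  rcases hcl with hd8 | ⟨h2d, hd7⟩
  · exact smul_eq_self_of_mem_decomp_vbar_inf_kerSubgroup_of_frame hd0 hd8 W C hC hK v vbar hv hvbar hne π hrel hr hpin κ' hκ'
      hδD hδκ x
  · exact smul_eq_self_of_mem_decomp_vbar_inf_kerSubgroup_of_frame_even_seven hd0 h2d hd7 W C hC hK v vbar hv hvbar hne π hrel hr hpin κ' hκ' hδD hδκ x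

end Summit.BirchSwinnertonDyer.BirchSwinnertonDyer.Theorems.PrintCf2.RestrictedSelmerPair

end
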